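import Mathlib
import HarnessLib
import Literature.NumberTheory.GaloisRepresentations.ResidualGaloisRep
import Literature.NumberTheory.GaloisRepresentations.CalegariEvenFontaineMazurTwo

/-! # Stub `stub_cyclotomicResidue` (line `local_clause_cut`, crux `EmptyWeightCore`, stmt-Langlands-17008)

For a unit `u ∈ ℤ_pˣ` (a value of the `p`-adic cyclotomic character) and an integer exponent
`m : ℤ`, the element `u ^ m ∈ ℚ_p ⊂ ℚ̄_p` is integral (it is the image of the unit `u ^ m` of
`ℤ_p` under `ℤ_p → ℚ_p → ℚ̄_p`, and the valuation of `ℚ̄_p = PadicAlgCl p` extends the `p`-adic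
norm), and its residue in `ℤ̄_p/𝔪 = padicAlgClResidueField p` is `(u mod p) ^ m` read through the
canonical `ℤ/p →+* ℤ̄_p/𝔪` (`zmodToPadicAlgClResidueField`): the reduction
`φ : ℤ_p →+* ℤ̄_p/𝔪` kills `p` (the residue field has characteristic `p`,
`charP_padicAlgClResidueField`), hence factors through `PadicInt.toZMod`, and ring homomorphisms
out of `ℤ/p` are unique.
-/

set_option linter.dupNamespace false

noncomputable section

namespace Summit.Langlands.Langlands.Cruxes.EmptyWeightCore.LocalClauseCut

open Literature.NumberTheory.GaloisRepresentations

/-- A ring homomorphism into a division ring sends the unit `u ^ m` (`m : ℤ`) to `(f u) ^ m`.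
[folklore] -/
private theorem map_val_units_zpow {R K : Type*} [Ring R] [DivisionRing K] (f : R →+* K)
    (u : Rˣ) (m : ℤ) : f ((u ^ m : Rˣ) : R) = (f (u : R)) ^ m := by
  have h := congrArg Units.val (map_zpow (Units.map (f : R →* K)) u m)
  rwa [Units.val_zpow_eq_zpow_val, Units.coe_map, Units.coe_map, MonoidHom.coe_coe] at h

/-- `ℤ_p → ℚ_p → ℚ̄_p` lands in `ℤ̄_p`: the valuation of `ℚ̄_p` extends the `p`-adic norm
(`PadicAlgCl.norm_extends`). [folklore] -/
private theorem algebraMap_padicInt_mem (p : ℕ) [Fact p.Prime] (z : ℤ_[p]) :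
    algebraMap ℚ_[p] (PadicAlgCl p) (z : ℚ_[p]) ∈ padicAlgClIntegers p := by
  rw [Valuation.mem_valuationSubring_iff, PadicAlgCl.valuation_def, ← NNReal.coe_le_coe,
    coe_nnnorm, PadicAlgCl.norm_extends, NNReal.coe_one]
  exact z.2

/-- **Residue of a power of a `p`-adic unit in `ℤ̄_p/𝔪`.**  For `u ∈ ℤ_pˣ` and `m : ℤ` there is
`x ∈ ℤ̄_p = padicAlgClIntegers p` with `x = u ^ m` in `ℚ̄_p` (image of `ℤ_p → ℚ_p → ℚ̄_p`) and
`x mod 𝔪 = ι (u mod p) ^ m`, `ι = zmodToPadicAlgClResidueField p : ℤ/p →+* ℤ̄_p/𝔪`: the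
reduction `ℤ_p → ℤ̄_p → ℤ̄_p/𝔪` kills `p` (`charP_padicAlgClResidueField`), so it factors through
`PadicInt.toZMod` (`PadicInt.ker_toZMod`, `RingHom.liftOfRightInverse`), and the induced map
`ℤ/p →+* ℤ̄_p/𝔪` is `ι` by uniqueness of ring homomorphisms out of `ℤ/p`; integer powers of
units pass through ring homomorphisms (`Units.map`, `map_zpow`).  Used to compare
`det ρ(σ) = ε(σ)^s` with `det ρ̄(σ)` in the residue field. [folklore] -/
theorem stub_cyclotomicResidue :
    ∀ (p : ℕ) [Fact p.Prime] (u : ℤ_[p]ˣ) (m : ℤ),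
      ∃ x : padicAlgClIntegers p,
        (x : PadicAlgCl p) = algebraMap ℚ_[p] (PadicAlgCl p) (((u : ℤ_[p]) : ℚ_[p]) ^ m) ∧
        IsLocalRing.residue (padicAlgClIntegers p) x =
          (zmodToPadicAlgClResidueField p (PadicInt.toZMod (u : ℤ_[p]))) ^ m := by
  intro p _ u m
  -- the integral structure map `ι : ℤ_p →+* ℤ̄_p` and its reduction `φ : ℤ_p →+* ℤ̄_p/𝔪`
  let ι : ℤ_[p] →+* padicAlgClIntegers p :=
    ((algebraMap ℚ_[p] (PadicAlgCl p)).comp (PadicInt.Coe.ringHom (p := p))).codRestrict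
      (padicAlgClIntegers p) (algebraMap_padicInt_mem p)
  let φ : ℤ_[p] →+* padicAlgClResidueField p :=
    (IsLocalRing.residue (padicAlgClIntegers p)).comp ι
  -- `φ` kills `p`, hence factors through `ℤ_p → ℤ/p`, and the factor map is the canonical one
  have hker : RingHom.ker (PadicInt.toZMod (p := p)) ≤ RingHom.ker φ := by
    rw [PadicInt.ker_toZMod, PadicInt.maximalIdeal_eq_span_p, Ideal.span_le,
      Set.singleton_subset_iff, SetLike.mem_coe, RingHom.mem_ker, map_natCast]
    haveI := charP_padicAlgClResidueField p
    exact CharP.cast_eq_zero _ p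
  have hφ : ∀ z : ℤ_[p], φ z = zmodToPadicAlgClResidueField p (PadicInt.toZMod z) := by
    intro z
    rw [Subsingleton.elim (zmodToPadicAlgClResidueField p)
      ((PadicInt.toZMod (p := p)).liftOfRightInverse (ZMod.cast : ZMod p → ℤ_[p])
        (ZMod.ringHom_rightInverse _) ⟨φ, hker⟩),
      RingHom.liftOfRightInverse_comp_apply]
  refine ⟨ι ((u ^ m : ℤ_[p]ˣ) : ℤ_[p]), ?_, ?_⟩
  · change algebraMap ℚ_[p] (PadicAlgCl p) (PadicInt.Coe.ringHom ((u ^ m : ℤ_[p]ˣ) : ℤ_[p])) = _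
    rw [map_val_units_zpow]
    rfl
  · change φ ((u ^ m : ℤ_[p]ˣ) : ℤ_[p]) = _
    rw [map_val_units_zpow, hφ]

end Summit.Langlands.Langlands.Cruxes.EmptyWeightCore.LocalClauseCut

end
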